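import Summits.CriticalPhenomena.SAWScalingLimit.Theorems.SAWRenewalTightnessTubeLowerBoundBPDOfTailHalving
import Summits.CriticalPhenomena.SAWScalingLimit.Theorems.SAWRenewalTightnessTubeLowerBoundSpanFloorVertex
import Summits.CriticalPhenomena.SAWScalingLimit.Theorems.SAWRenewalTightnessTubeLowerBoundProfilePotentialDefs

/-!
# Crux `SAWRenewalTightness.TubeLowerBound` (stmt-CriticalPhenomena-4730): tail halving ⇒ Kesten's span-renewal floor

Census link of lead a1 (`prover-line-stmt-CriticalPhenomena-4730-a1-0`, 2026-08-17) on the common milestone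
`SpanRenewalFloor` of the crux's lines (the `x_c`-mass of bridges of span exactly `L` is `≥ c L^{−C}`): the weakest
single-piece anti-lacunarity input known to us,

  TAIL HALVING of Kesten's critical irreducible-bridge span law — for some `δ > 0` and every `m ≥ 1`,
  `P(m < span ≤ 2m) ≥ δ · P(span > m)` (as finite partial sums of `x_c`-masses of irreducible bridge words),

implies `SpanRenewalFloor` (vertex form, the `ProfilePotential.SpanRenewalFloor` of the line's Defs, p130472):
`breakPointDensity_of_tailHalving` (p132534: the renewal identity `Σ_{k<D} u_k T_{D−1−k} = 1` in partial-sum form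
makes the first renewal after level `D−1` land in `[D, 2D)` with mass `≥ min(δ, x_c)/2`) composed with the landed
`spanRenewalFloor_of_breakPointDensity'` (p120206 + p121181: renewal halving, a constant per dyadic scale).  With the
landed `lacunaryRenewal_noPolynomialFloor` (p120914: an abstract renewal law WITHOUT tail halving has no polynomial
floor) this brackets exactly what a renewal-based proof of the milestone must supply.  Registered sub-goal
`spanRenewalFloor_of_tailHalving` of stmt-CriticalPhenomena-4730.  Sources: H. Kesten, J. Math. Phys. 4 (1963) §4;
N. Madras, G. Slade, *The Self-Avoiding Walk* (1993) §4.2.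
-/

noncomputable section

namespace Summit.CriticalPhenomena.SAWScalingLimit.Theorems.TubeLowerBound.ProfilePotential

open scoped BigOperators Classical
open Literature.Probability.LatticeModels
open Literature.Probability.RandomPlanarGeometry Literature.Probability.RandomPlanarGeometry.SAW
open Summit.CriticalPhenomena.SAWScalingLimit.Theorems.TubeLowerBound.SubcriticalRenewalFloor

/-- **Tail halving ⇒ Kesten's span-renewal floor.**  If Kesten's critical irreducible-bridge span law satisfies
`P(m < span ≤ 2m) ≥ δ P(span > m)` for some `δ > 0` and all `m ≥ 1` (finite partial-sum form over the irreducible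
bridge words of `SAWWordBridges.lean`), then the `x_c`-mass of the vertex-function bridges of span exactly `L` is
`≥ c L^{−C}` for every `L ≥ 1` (`SpanRenewalFloor`).  Composite of the landed `breakPointDensity_of_tailHalving` and
`spanRenewalFloor_of_breakPointDensity'`. -/
theorem spanRenewalFloor_of_tailHalving :
    (∃ δ : ℝ, 0 < δ ∧ ∀ m : ℕ, 1 ≤ m → ∀ N : ℕ, ∃ N' : ℕ, δ * (∑ n ∈ Finset.range (N + 1), ∑ _w ∈ (sawWords n).filter (fun w => IsIrrBridge w ∧ (m : ℤ) < xEnd w), criticalFugacity ^ n) ≤ ∑ n ∈ Finset.range (N' + 1), ∑ _w ∈ (sawWords n).filter (fun w => IsIrrBridge w ∧ (m : ℤ) < xEnd w ∧ xEnd w ≤ 2 * (m : ℤ)), criticalFugacity ^ n) → SpanRenewalFloor :=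
  fun h => spanRenewalFloor_of_breakPointDensity' (breakPointDensity_of_tailHalving h)

end Summit.CriticalPhenomena.SAWScalingLimit.Theorems.TubeLowerBound.ProfilePotential

end
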